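import Summits.CriticalPhenomena.SAWScalingLimit.Theorems.SAWDefectDecoherenceBoundaryClosureRPhaseFlatChart
import Summits.CriticalPhenomena.SAWScalingLimit.Theorems.SAWDefectDecoherenceBoundaryClosureRPhaseCornerGeometry
import Summits.CriticalPhenomena.SAWScalingLimit.Theorems.SAWDefectDecoherenceBoundaryClosureRPhaseWedge
import Summits.CriticalPhenomena.SAWScalingLimit.Theorems.SAWDefectDecoherenceBoundaryClosureRCornerStructure
import HarnessLib

/-!
# Crux `BoundaryClosureR` (stmt-CriticalPhenomena-14004), line `polygon-parity-squeeze`,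
# stub `boundaryPhaseBookkeeping` (piece D): the jump of `arg Φ'` across a genuine corner

Let `Φ : Ω → ℍₒ` be a conformal frame of the Dobrushin domain `D` (`‖Φ‖ → ∞` at the root) and
`L` a continuous logarithm of `Φ'` on `Ω`.  At a genuine zigzag corner `c`
(`Ω ∩ B(c, s) = (H_k ∩ H_{k'}) ∩ B` or `(H_k ∪ H_{k'}) ∩ B`, `n_{k'} ≠ ± n_k`, root outside the
ball) the boundary values of `im L` at the points of the two sides close to `c` differ by MINUS
the turning angle: `α₂ = α₁ - arg(n_{k'}/n_k)` (`cornerChart`).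

Proof.  The corner is a wedge of opening `θπ`, `0 < θ < 2` (`wedge_presentation`), so by the
landed corner structure `Φ' = u₁ · s^{1/θ-1}` near `c` with `u₁` continuous and zero-free on the
closed wedge; hence `L = log-branch(u₁) + (1/θ - 1) log s + const` on the (preconnected) corner
ball, and a boundary value `α` of `im L` at a side point `q` satisfies
`|α - im log-branch(u₁)(q) - const| ≤ |1/θ - 1| θπ/2`.  For `q` close to `c` the `u₁`-terms of
the two sides differ by less than `ε`, so `|α₂ - α₁| < |1-θ|π + 2ε < 2π - |T|`,
`T = arg(n_{k'}/n_k)` (`|T| < π`, `|1 - θ| < 1`).  On the other hand the flat charts of the two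
sides give `e^{iα₁} = i conj n_k`, `e^{iα₂} = i conj n_{k'}`, so `α₂ - α₁ + T ∈ 2πℤ`; the only
admissible multiple is `0`.

References: Pommerenke, *Boundary Behaviour of Conformal Maps* (1992), Thm. 3.9.
-/

noncomputable section

open scoped Topology ComplexConjugate
open Filter Set Metric Complex
open UpperHalfPlane (upperHalfPlaneSet)
open Literature.Probability.RandomPlanarGeometry
open Summit.CriticalPhenomena.SAWScalingLimit.Theorems.PickHalfPlane

namespace Summit.CriticalPhenomena.SAWScalingLimit.Theorems.PolygonParitySqueeze

namespace PhaseChart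

/-- The turning angle of a genuine corner is `< π` in absolute value, and
`conj(n_{k'}/n_k) = e^{-iT}`. [folklore] -/
theorem turning_lt_pi {k k' : Fin 6} (hk' : innerNormal k' ≠ -innerNormal k) :
    |arg (innerNormal k' / innerNormal k)| < Real.pi ∧
      conj (innerNormal k' / innerNormal k) =
        exp (-(arg (innerNormal k' / innerNormal k) : ℂ) * I) := by
  have hk0 : innerNormal k ≠ 0 := fun h => by
    have := norm_innerNormal k; rw [h, norm_zero] at this; exact zero_ne_one this
  have h1 : ‖innerNormal k' / innerNormal k‖ = 1 := by
    rw [norm_div, norm_innerNormal, norm_innerNormal, div_one]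
  refine ⟨?_, ?_⟩
  · refine abs_lt.2 ⟨neg_pi_lt_arg _, lt_of_le_of_ne (arg_le_pi _) fun h => hk' ?_⟩
    obtain ⟨hre, him⟩ := arg_eq_pi_iff.1 h
    have habs : |(innerNormal k' / innerNormal k).re| = 1 := by rw [abs_re_eq_norm.2 him, h1]
    have hre1 : (innerNormal k' / innerNormal k).re = -1 := by
      rw [abs_of_neg hre] at habs; linarith
    have : innerNormal k' / innerNormal k = -1 := Complex.ext (by simpa using hre1) (by simpa using him)
    rw [div_eq_iff hk0] at this
    rw [this, neg_one_mul]
  · have := norm_mul_exp_arg_mul_I (innerNormal k' / innerNormal k)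
    rw [h1, ofReal_one, one_mul] at this
    conv_lhs => rw [← this]
    rw [← exp_conj, map_mul, conj_ofReal, conj_I]
    ring_nf

/-- **The jump of the boundary values of `arg Φ'` across a genuine corner.** See the module
docstring. [cite: PommerenkeBBCM1992, Thm. 3.9] -/
theorem cornerChart (D : DobrushinDomain) (Φ : ConformalEquiv D.carrier upperHalfPlaneSet)
    (hΦ0 : Tendsto (fun z => ‖Φ z‖) (𝓝[D.carrier] (D.pt 0)) atTop)
    {L : ℂ → ℂ} (hL : ContinuousOn L D.carrier)
    (hexp : ∀ z ∈ D.carrier, exp (L z) = deriv Φ z)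
    {c : ℂ} (hc : c ∈ frontier D.carrier) {k k' : Fin 6}
    (hk : innerNormal k' ≠ innerNormal k) (hk' : innerNormal k' ≠ -innerNormal k)
    {s : ℝ} (hs : 0 < s)
    (hset : D.carrier ∩ ball c s = halfPlane k c ∩ halfPlane k' c ∩ ball c s ∨
      D.carrier ∩ ball c s = (halfPlane k c ∪ halfPlane k' c) ∩ ball c s)
    (h0 : D.pt 0 ∉ ball c s) :
    ∃ t : ℝ, 0 < t ∧ t ≤ s ∧
      ∀ z₁ ∈ frontier D.carrier ∩ ball c t, z₁ ≠ c → ((z₁ - c) * conj (innerNormal k)).re = 0 →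
      ∀ z₂ ∈ frontier D.carrier ∩ ball c t, z₂ ≠ c → ((z₂ - c) * conj (innerNormal k')).re = 0 →
      ∀ α₁ α₂ : ℝ, Tendsto (fun w => (L w).im) (𝓝[D.carrier] z₁) (𝓝 α₁) →
        Tendsto (fun w => (L w).im) (𝓝[D.carrier] z₂) (𝓝 α₂) →
        α₂ = α₁ - arg (innerNormal k' / innerNormal k) := by
  obtain ⟨Φs, hΦsc, hΦse, hΦsr⟩ := Identification.exists_frameExtension D Φ hΦ0
  have hU : IsOpen D.carrier := D.isOpen
  have hccl : c ∈ closure D.carrier := frontier_subset_closure hc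
  -- Step 1: the corner is a wedge of opening `θπ`
  obtain ⟨ψ, θ₁, θ₂, hθ₁0, hθ₁1, hθ₂1, hθ₂2, hWI, hWU⟩ := PhaseGeometry.wedge_presentation hk hk' c
  obtain ⟨θ, hθ0, hθ2, hW⟩ : ∃ θ : ℝ, 0 < θ ∧ θ < 2 ∧ D.carrier ∩ ball c s =
      {w : ℂ | w ≠ c ∧ |arg ((w - c) * exp (-(ψ : ℂ) * I))| < θ * Real.pi / 2} ∩ ball c s := by
    rcases hset with h | h
    · exact ⟨θ₁, hθ₁0, by linarith, by rw [h, hWI]⟩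
    · exact ⟨θ₂, by linarith, hθ₂2, by rw [h, hWU]⟩
  -- Step 2: the corner structure `Φ' = u₁ · s^{1/θ - 1}`
  have hsub0 : closure D.carrier ∩ ball c s ⊆ closure D.carrier \ {D.pt 0} := fun w hw =>
    ⟨hw.1, fun h => h0 (mem_singleton_iff.1 h ▸ hw.2)⟩
  obtain ⟨r', u, u₁, hr'0, hr's, -, hu₁c, hne, -, hder⟩ := cornerStructure D.carrier c ψ θ s hU
    hθ0 hθ2 hs hW Φ Φs (Φ.differentiableOn) (Φ.injOn) (fun z hz => Φ.mapsTo hz)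
    (hΦsc.mono hsub0) (hΦse.mono inter_subset_left) (fun z hz => hΦsr z hz.1)
  -- Step 3: the turning angle and the tolerance `ε`
  set T : ℝ := arg (innerNormal k' / innerNormal k) with hT
  obtain ⟨hTpi, hconjT⟩ := turning_lt_pi hk'
  have h1θ : |1 - θ| < 1 := abs_lt.2 ⟨by linarith, by linarith⟩
  have h1θπ : |1 - θ| * Real.pi < Real.pi := by nlinarith [Real.pi_pos]
  set ε : ℝ := (2 * Real.pi - |T| - |1 - θ| * Real.pi) / 4 with hε
  have hε0 : 0 < ε := by rw [hε]; linarith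
  -- Step 4: a radius `r₃` on which `u₁/u₁(c)` stays near `1`
  have hcmem : c ∈ closure D.carrier ∩ ball c r' := ⟨hccl, mem_ball_self hr'0⟩
  have hu₁c0 : u₁ c ≠ 0 := (hne c hcmem).2
  set f : ℂ → ℂ := fun w => u₁ w / u₁ c with hf
  have hfc : ContinuousOn f (closure D.carrier ∩ ball c r') := hu₁c.div_const _
  have hf1 : f c = 1 := div_self hu₁c0
  have hlogf : ContinuousWithinAt (fun w => log (f w)) (closure D.carrier ∩ ball c r') c := by
    have h1 : ContinuousAt log (f c) := by rw [hf1]; exact continuousAt_clog (by simp [slitPlane])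
    exact h1.comp_continuousWithinAt (hfc c hcmem)
  obtain ⟨δ₁, hδ₁, hδ₁f⟩ := Metric.continuousWithinAt_iff.1 (hfc c hcmem) 1 one_pos
  obtain ⟨δ₂, hδ₂, hδ₂f⟩ := Metric.continuousWithinAt_iff.1 hlogf ε hε0
  set r₃ : ℝ := min r' (min δ₁ δ₂) with hr₃
  have hr₃0 : 0 < r₃ := lt_min hr'0 (lt_min hδ₁ hδ₂)
  have hr₃r' : r₃ ≤ r' := min_le_left _ _
  have hr₃s : r₃ ≤ s := hr₃r'.trans hr's
  have hsub3 : closure D.carrier ∩ ball c r₃ ⊆ closure D.carrier ∩ ball c r' := fun w hw =>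
    ⟨hw.1, ball_subset_ball hr₃r' hw.2⟩
  have hnear1 : ∀ w ∈ closure D.carrier ∩ ball c r₃, ‖f w - 1‖ < 1 := by
    intro w hw
    have h := hδ₁f (hsub3 hw) (lt_of_lt_of_le (mem_ball.1 hw.2) ((min_le_right _ _).trans (min_le_left _ _)))
    rwa [dist_eq_norm, hf1] at h
  have hnearε : ∀ w ∈ closure D.carrier ∩ ball c r₃, |arg (f w)| < ε := by
    intro w hw
    have h := hδ₂f (hsub3 hw) (lt_of_lt_of_le (mem_ball.1 hw.2) ((min_le_right _ _).trans (min_le_right _ _)))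
    rw [dist_eq_norm, hf1, log_one, sub_zero] at h
    calc |arg (f w)| = |(log (f w)).im| := by rw [log_im]
      _ ≤ ‖log (f w)‖ := abs_im_le_norm _
      _ < ε := h
  have hslitf : ∀ w ∈ closure D.carrier ∩ ball c r₃, f w ∈ slitPlane := fun w hw => by
    have := mem_slitPlane_of_norm_lt_one (hnear1 w hw)
    rwa [add_sub_cancel] at this
  -- Step 5: the logarithm `M₁` of `u₁` on the closed piece
  set M₁ : ℂ → ℂ := fun w => log (f w) + log (u₁ c) with hM₁
  have hM₁c : ContinuousOn M₁ (closure D.carrier ∩ ball c r₃) := by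
    refine ContinuousOn.add ?_ continuousOn_const
    exact ContinuousOn.comp (g := log) (fun x hx => (continuousAt_clog hx).continuousWithinAt)
      (hfc.mono hsub3) hslitf
  have hM₁exp : ∀ w ∈ closure D.carrier ∩ ball c r₃, exp (M₁ w) = u₁ w := by
    intro w hw
    simp only [hM₁, hf]
    rw [exp_add, exp_log (slitPlane_ne_zero (hslitf w hw)), exp_log hu₁c0, div_mul_cancel₀ _ hu₁c0]
  have hM₁im : ∀ w, (M₁ w).im = arg (f w) + (log (u₁ c)).im := fun w => by
    simp only [hM₁]; rw [add_im, log_im]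
  -- Step 6: the logarithm `M₂ = M₁ + (1/θ - 1) log s` of `Φ'` on the open corner ball `V`
  set e : ℂ := exp (-(ψ : ℂ) * I) with he
  have he0 : e ≠ 0 := exp_ne_zero _
  set sf : ℂ → ℂ := fun w => (w - c) * e with hsf
  set V : Set ℂ := D.carrier ∩ ball c r₃ with hV
  have hVsub : V ⊆ closure D.carrier ∩ ball c r₃ := fun w hw => ⟨subset_closure hw.1, hw.2⟩
  have hVwedge : ∀ w ∈ V, w ≠ c ∧ |arg (sf w)| < θ * Real.pi / 2 := by
    intro w hw
    have : w ∈ D.carrier ∩ ball c s := ⟨hw.1, ball_subset_ball hr₃s hw.2⟩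
    rw [hW] at this
    exact this.1
  have hsfslit : ∀ w ∈ V, sf w ∈ slitPlane := by
    intro w hw
    obtain ⟨hwc, harg⟩ := hVwedge w hw
    refine mem_slitPlane_iff_arg.2 ⟨fun h => ?_, mul_ne_zero (sub_ne_zero.2 hwc) he0⟩
    rw [h, abs_of_pos Real.pi_pos] at harg
    nlinarith [Real.pi_pos]
  set a : ℝ := 1 / θ - 1 with ha
  set M₂ : ℂ → ℂ := fun w => M₁ w + (a : ℂ) * log (sf w) with hM₂
  have hsfc : Continuous sf := by simp only [hsf]; fun_prop
  have hM₂c : ContinuousOn M₂ V := by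
    refine (hM₁c.mono hVsub).add (continuousOn_const.mul ?_)
    exact ContinuousOn.comp (g := log) (fun x hx => (continuousAt_clog hx).continuousWithinAt)
      hsfc.continuousOn hsfslit
  have hM₂exp : ∀ w ∈ V, exp (L w) = ((1 : ℝ) : ℂ) * exp (M₂ w) := by
    intro w hw
    simp only [hM₂]
    rw [ofReal_one, one_mul, exp_add, hM₁exp w (hVsub hw), hexp w hw.1,
      hder w ⟨hw.1, ball_subset_ball hr₃r' hw.2⟩]
  -- Step 7: `L = M₂ + C` on the preconnected `V`
  have hVpc : IsPreconnected V := by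
    have hV' : V = halfPlane k c ∩ halfPlane k' c ∩ ball c r₃ ∨
        V = (halfPlane k c ∪ halfPlane k' c) ∩ ball c r₃ := by
      rcases hset with h | h
      · exact Or.inl (PhaseGeometry.inter_eq_inter_of_subset_ball h (ball_subset_ball hr₃s))
      · exact Or.inr (PhaseGeometry.inter_eq_inter_of_subset_ball h (ball_subset_ball hr₃s))
    exact PhaseGeometry.isPreconnected_corner hk' c r₃ hV'
  obtain ⟨j₀, hj₀⟩ := PhaseGeometry.exists_testPoint_mem_inter hk' c hr₃0
  set q₀ : ℂ := c + ((r₃ / 2 : ℝ) : ℂ) * innerNormal j₀ with hq₀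
  have hq₀V : q₀ ∈ V := by
    have : q₀ ∈ D.carrier ∩ ball c s := by
      rcases hset with h | h
      · rw [h]; exact ⟨hj₀.1, ball_subset_ball hr₃s hj₀.2⟩
      · rw [h]; exact ⟨Or.inl hj₀.1.1, ball_subset_ball hr₃s hj₀.2⟩
    exact ⟨this.1, hj₀.2⟩
  have hLV : ContinuousOn L V := hL.mono inter_subset_left
  have key := Identification.sub_eq_sub_of_exp_eq_mul_exp hVpc (subset_closure hq₀V) hM₂c hLV
    one_pos hM₂exp (hM₂c.continuousWithinAt hq₀V) (hLV.continuousWithinAt hq₀V)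
  set C : ℂ := L q₀ - M₂ q₀ with hC
  have hLeq : ∀ w ∈ V, L w = M₂ w + C := fun w hw => by
    have h := key w hw; rw [hC]; linear_combination h
  -- Step 8: boundary values of `im L` at side points: the `u₁`-part and the bounded `arg s`-part
  set B : ℝ := |a| * (θ * Real.pi / 2) with hB
  have hBeq : 2 * B = |1 - θ| * Real.pi := by
    have : |a| * θ = |1 - θ| := by
      calc |a| * θ = |a| * |θ| := by rw [abs_of_pos hθ0]
        _ = |a * θ| := (abs_mul a θ).symm
        _ = |1 - θ| := by rw [ha, sub_mul, one_div_mul_cancel hθ0.ne', one_mul]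
    rw [hB]
    calc 2 * (|a| * (θ * Real.pi / 2)) = (|a| * θ) * Real.pi := by ring
      _ = |1 - θ| * Real.pi := by rw [this]
  have hbound : ∀ q ∈ frontier D.carrier ∩ ball c r₃, ∀ α : ℝ,
      Tendsto (fun w => (L w).im) (𝓝[D.carrier] q) (𝓝 α) → |α - (M₁ q).im - C.im| ≤ B := by
    rintro q ⟨hqfr, hqr⟩ α hα
    have hqcl : q ∈ closure D.carrier ∩ ball c r₃ := ⟨frontier_subset_closure hqfr, hqr⟩
    haveI : NeBot (𝓝[D.carrier] q) := mem_closure_iff_nhdsWithin_neBot.1 hqcl.1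
    have hVmem : V ∈ 𝓝[D.carrier] q :=
      inter_mem self_mem_nhdsWithin (mem_nhdsWithin_of_mem_nhds (isOpen_ball.mem_nhds hqr))
    have hM₁q : Tendsto M₁ (𝓝[D.carrier] q) (𝓝 (M₁ q)) :=
      ((hM₁c q hqcl).mono_of_mem_nhdsWithin (mem_of_superset hVmem hVsub)).tendsto
    have hF : Tendsto (fun w => (L w).im - (M₁ w).im - C.im) (𝓝[D.carrier] q)
        (𝓝 (α - (M₁ q).im - C.im)) :=
      (hα.sub ((continuous_im.tendsto _).comp hM₁q)).sub tendsto_const_nhds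
    have hFeq : ∀ᶠ w in 𝓝[D.carrier] q, |(L w).im - (M₁ w).im - C.im| ≤ B := by
      filter_upwards [hVmem] with w hw
      have h1 : (L w).im - (M₁ w).im - C.im = a * arg (sf w) := by
        rw [hLeq w hw]
        simp only [hM₂]
        rw [add_im, add_im, im_ofReal_mul, log_im]
        ring
      rw [h1, abs_mul, hB]
      exact mul_le_mul_of_nonneg_left (hVwedge w hw).2.le (abs_nonneg _)
    exact le_of_tendsto hF.abs hFeq
  -- Step 9: directions from the flat charts of the two sides
  have hdir : ∀ (j j' : Fin 6), innerNormal j' ≠ innerNormal j → innerNormal j' ≠ -innerNormal j →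
      (D.carrier ∩ ball c s = halfPlane j c ∩ halfPlane j' c ∩ ball c s ∨
        D.carrier ∩ ball c s = (halfPlane j c ∪ halfPlane j' c) ∩ ball c s) →
      ∀ q ∈ frontier D.carrier ∩ ball c s, q ≠ c → ((q - c) * conj (innerNormal j)).re = 0 →
      ∀ α : ℝ, Tendsto (fun w => (L w).im) (𝓝[D.carrier] q) (𝓝 α) →
        exp ((α : ℂ) * I) = I * conj (innerNormal j) := by
    rintro j j' hj hj' hsetj q ⟨hqfr, hqs⟩ hqc hlev α hα
    haveI : NeBot (𝓝[D.carrier] q) := mem_closure_iff_nhdsWithin_neBot.1 (frontier_subset_closure hqfr)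
    obtain ⟨t₁, ht₁, hsub₁, hflat₁⟩ := PhaseGeometry.flat_of_mem_ray hU hj hj' hsetj hqfr hqs hqc hlev
    obtain ⟨t₂, α', ht₂, -, hdir', hT'⟩ := flatChart D Φ hΦ0 hL hexp (norm_innerNormal j) ht₁ hflat₁
      (fun h => h0 (hsub₁ h))
    have hα' := hT' q (mem_ball_self ht₂) (by rw [sub_self, zero_mul, zero_re])
    rw [tendsto_nhds_unique hα hα']
    exact hdir'
  -- Step 10: conclusion
  refine ⟨r₃, hr₃0, hr₃s, ?_⟩
  rintro z₁ ⟨hz₁fr, hz₁r⟩ hz₁c hlev₁ z₂ ⟨hz₂fr, hz₂r⟩ hz₂c hlev₂ α₁ α₂ hα₁ hα₂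
  have hset' : D.carrier ∩ ball c s = halfPlane k' c ∩ halfPlane k c ∩ ball c s ∨
      D.carrier ∩ ball c s = (halfPlane k' c ∪ halfPlane k c) ∩ ball c s := by
    rcases hset with h | h
    · left; rw [h, inter_comm (halfPlane k c)]
    · right; rw [h, union_comm]
  have he₁ := hdir k k' hk hk' hset z₁ ⟨hz₁fr, ball_subset_ball hr₃s hz₁r⟩ hz₁c hlev₁ α₁ hα₁
  have he₂ := hdir k' k hk.symm (fun h => hk' (by rw [h, neg_neg])) hset' z₂
    ⟨hz₂fr, ball_subset_ball hr₃s hz₂r⟩ hz₂c hlev₂ α₂ hα₂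
  -- `α₂ - α₁ + T ∈ 2πℤ`
  have hk0 : innerNormal k ≠ 0 := fun h => by
    have := norm_innerNormal k; rw [h, norm_zero] at this; exact zero_ne_one this
  have hck0 : conj (innerNormal k) ≠ 0 := (map_ne_zero _).2 hk0
  have hexp1 : exp (((α₂ - α₁ + T : ℝ) : ℂ) * I) = 1 := by
    have h1 : exp ((α₂ : ℂ) * I) = exp ((α₁ : ℂ) * I) * exp (-(T : ℂ) * I) := by
      rw [he₁, he₂, ← hconjT, map_div₀]
      field_simp
    push_cast
    rw [show ((α₂ : ℂ) - α₁ + T) * I = α₂ * I + (-(α₁ * I)) + (- (-(T : ℂ) * I)) by ring,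
      exp_add, exp_add, h1, exp_neg, exp_neg]
    field_simp
  obtain ⟨m, hm⟩ := Complex.exp_eq_one_iff.1 hexp1
  have hmreal : α₂ - α₁ + T = m * (2 * Real.pi) := by
    have := congrArg Complex.im hm
    simpa using this
  -- `|α₂ - α₁| < 2π - |T|`
  have hz₁cl : z₁ ∈ closure D.carrier ∩ ball c r₃ := ⟨frontier_subset_closure hz₁fr, hz₁r⟩
  have hz₂cl : z₂ ∈ closure D.carrier ∩ ball c r₃ := ⟨frontier_subset_closure hz₂fr, hz₂r⟩
  have hb₁ := hbound z₁ ⟨hz₁fr, hz₁r⟩ α₁ hα₁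
  have hb₂ := hbound z₂ ⟨hz₂fr, hz₂r⟩ α₂ hα₂
  have ha₁ := hnearε z₁ hz₁cl
  have ha₂ := hnearε z₂ hz₂cl
  have hsmall : |α₂ - α₁| < 2 * Real.pi - |T| := by
    have hdecomp : α₂ - α₁ = (α₂ - (M₁ z₂).im - C.im) - (α₁ - (M₁ z₁).im - C.im) +
        (arg (f z₂) - arg (f z₁)) := by rw [hM₁im z₁, hM₁im z₂]; ring
    rw [hdecomp]
    have h1 := abs_sub (α₂ - (M₁ z₂).im - C.im) (α₁ - (M₁ z₁).im - C.im)
    have h2 := abs_sub (arg (f z₂)) (arg (f z₁))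
    have h3 := abs_add_le ((α₂ - (M₁ z₂).im - C.im) - (α₁ - (M₁ z₁).im - C.im))
      (arg (f z₂) - arg (f z₁))
    have h4 : 4 * ε = 2 * Real.pi - |T| - |1 - θ| * Real.pi := by rw [hε]; ring
    linarith
  -- hence `m = 0`
  have hm0 : m = 0 := by
    by_contra hmne
    have h1 : (1 : ℝ) ≤ |(m : ℝ)| := by
      rw [← Int.cast_abs]; exact_mod_cast Int.one_le_abs hmne
    have h2 : |α₂ - α₁| ≥ 2 * Real.pi - |T| := by
      have h3 : α₂ - α₁ = m * (2 * Real.pi) - T := by linarith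
      rw [h3]
      have h4 := abs_sub_abs_le_abs_sub ((m : ℝ) * (2 * Real.pi)) T
      have h5 : |(m : ℝ) * (2 * Real.pi)| = |(m : ℝ)| * (2 * Real.pi) := by
        rw [abs_mul, abs_of_pos (by positivity : (0 : ℝ) < 2 * Real.pi)]
      nlinarith [Real.pi_pos]
    linarith
  rw [hm0, Int.cast_zero, zero_mul] at hmreal
  linarith

/-! ### Registered form -/

/-- **Registered helper `phaseBookkeeping_cornerChart`** (∀-closed form of `cornerChart`; sub-goal
of stub `boundaryPhaseBookkeeping`, crux stmt-CriticalPhenomena-14004, line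
`polygon-parity-squeeze`): the jump of the boundary values of `arg Φ'` across a genuine corner is
minus the turning angle. [cite: PommerenkeBBCM1992, Thm. 3.9] -/
theorem phaseBookkeeping_cornerChart : ∀ (D : DobrushinDomain) (Φ : ConformalEquiv D.carrier UpperHalfPlane.upperHalfPlaneSet), Filter.Tendsto (fun z => ‖Φ z‖) (𝓝[D.carrier] (D.pt 0)) Filter.atTop → ∀ (L : ℂ → ℂ), ContinuousOn L D.carrier → (∀ z ∈ D.carrier, Complex.exp (L z) = deriv Φ z) → ∀ c ∈ frontier D.carrier, ∀ (k k' : Fin 6) (s : ℝ), innerNormal k' ≠ innerNormal k → innerNormal k' ≠ -innerNormal k → 0 < s → (D.carrier ∩ Metric.ball c s = halfPlane k c ∩ halfPlane k' c ∩ Metric.ball c s ∨ D.carrier ∩ Metric.ball c s = (halfPlane k c ∪ halfPlane k' c) ∩ Metric.ball c s) → D.pt 0 ∉ Metric.ball c s → ∃ t : ℝ, 0 < t ∧ t ≤ s ∧ ∀ z₁ ∈ frontier D.carrier ∩ Metric.ball c t, z₁ ≠ c → ((z₁ - c) * (starRingEnd ℂ) (innerNormal k)).re = 0 → ∀ z₂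 ∈ frontier D.carrier ∩ Metric.ball c t, z₂ ≠ c → ((z₂ - c) * (starRingEnd ℂ) (innerNormal k')).re = 0 → ∀ α₁ α₂ : ℝ, Filter.Tendsto (fun w => (L w).im) (𝓝[D.carrier] z₁) (𝓝 α₁) → Filter.Tendsto (fun w => (L w).im) (𝓝[D.carrier] z₂) (𝓝 α₂) → α₂ = α₁ - Complex.arg (innerNormal k' / innerNormal k) :=
  fun D Φ hΦ0 _ hL hexp _ hc _ _ _ hk hk' hs hset h0 => cornerChart D Φ hΦ0 hL hexp hc hk hk' hs hset h0

end PhaseChart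

end Summit.CriticalPhenomena.SAWScalingLimit.Theorems.PolygonParitySqueeze

end
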